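import Literature.MathematicalPhysics.QuantumFieldTheory.Balaban1983to89.Node00.BackgroundCurrentCompare
import Literature.MathematicalPhysics.QuantumFieldTheory.Balaban1983to89.Node00.WilsonActionFirstVariationCoDiv
import Literature.MathematicalPhysics.QuantumFieldTheory.Balaban1983to89.B9TorusCalculus
import Literature.MathematicalPhysics.QuantumFieldTheory.Balaban1983to89.B11Eq26ActionExpansion
import Literature.MathematicalPhysics.QuantumFieldTheory.Balaban1983to89.MatrixNorms
import Literature.MathematicalPhysics.QuantumFieldTheory.Balaban1983to89.Node00.HessianOperatorAtBackground

/-!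
# BalabanUVNodes ∕ N07 — [Balaban1985Variational] SECT. B «AN EXPANSION OF THE ACTION» ((24)–(28) pp. 281–282) AT NODE 00's OBJECTS:
# the lineage's generic lattice calculus (pv27 `B9Eq39Adjoint`: `D = curlη`, `D* = divPη`, `J`, `⟨A,ΔA⟩ = hessPair`, the exact expansion
# (26) = [5] (3.12) `eq312`, (27) = `B11Eq27Current.eq27`) READ AT THE TORUS OF RECORD `Site (F.P K) j` WITH AN `SU(N)` BACKGROUND OF RECORD
# `U₀ : GaugeField (F.P K) j (SU N)` — every hypothesis of the generic statements DISCHARGED (`hT`, `hU`, `hτ`, `hτs`, `d = 4`), the zeroth-order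
# term identified with THE ACTION OF RECORD `Setup.wilsonAction4`, the current `J` identified with [6] (1.2)'s divergence `covDivT` (the letter of
# [15] (2) ∕ `InUkClassB11` ∕ dag-n07-e's first-variation theorem)

Track A of `YM-PLAN.md` (cell `pub-ymgap`, HUMAN RULING D-0062 ∕ D-0149), DAG node **N07** = [Balaban1985Variational] = T. Bałaban, *The variational problem and
background fields in renormalization group method for lattice gauge theories*, Commun. Math. Phys. **102** (1985) 277–309; Sect. B pp. 281–285 read first-hand
(held text `paper:balaban1985-cmp102-variational-background`, PDF pp. 5–9).  Width seat `pub-ymgap-dag-n07-w1` (g0), item S1 of dag-n07-e's `W-SEAT-START-LIST-N07.md`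
(«[15] Sect. B at objects»); audit `HOME/pub-ymgap-dag-n07-w1/S1-SECTB-AUDIT.md` (row D3).  `--kind proof --supports stmt-QuantumFields-20542 --as helper` (K1⁷; count-neutral).

WHY.  The audit found [15] Sect. B typed GENERICALLY (pv27: sites `S`, directions `ι`, shifts `T`, background `U : ι → S → 𝔸ˣ`, tracial `τ`; 277 importers)
and instantiated at the tori `Site P j` (`B9TorusCalculus.torusT`), with dag-n01-b's junctions to [6]'s torus letters (`Node00/BackgroundCurrentCompare`:
`covDivT_eq_divPη`, `plaqFT_eq_plaqField`, `dirForm_cfgGL_inv_eq_star`).  What no file states is Sect. B FOR THE ACTION OF RECORD: `Setup.wilsonAction4` — the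
functional (5) that NODE 00's class (2) ∕ (6) ∕ (8) (`InUkClassB11`, `IsBackground (avOfRecord …)`), K0's `Prop8RegSepTopStep` and dag-n07-e's criticality reading
(35a–35g) are ALL about — is `Σ_{p : Plaq} (1 − reTr (plaqHol U p))`, while pv27's (26) expands its own complexified `action T η d τ` over `posPlaq`.  This file closes
that junction once, so that S2 ∕ S4 seats (Sect. C chart (47), Sect. F (157): `H` minimises `½⟨A, ΔA⟩`) can read (26)'s SECOND-order term and the remainder for the
action of record BY NAME (the FIRST-order term is dag-n07-e's `hasDerivAt_wilsonAction4_covDivT`, 35f).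

CONTENTS (theorems only; `τ_N := N⁻¹·tr` is written as the term `(N : ℂ)⁻¹ • Matrix.traceLinearMap (Fin N) ℂ ℂ`, no definition).
* §1 the trace functional of record: `trN_apply` (= `MatrixNorms.ntr`), `trN_mul_comm` (`hτ`), `trN_star` (`hτs`), `trN_one`.
* §2 the background datum of record `(torusT P j, dirForm (cfgGL N U))`: `coe_dirForm_cfgGL`, ★ `coe_plaqU_torusT_cfgGL` (pv27's plaquette unit IS `plaqHol U p`),
  `plaqU_torusT_cfgGL_inv_eq_star` (`hU` for plaquettes), `wil_plaqU_cfgGL_eq` (`wil τ_N (U(∂p)) = 1 − reTr (plaqHol U p)`), ★ `action_torusT_cfgGL_eq_wilsonAction4`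
  (pv27's `action (torusT P j) η 4 τ_N (dirForm (cfgGL N U)) = wilsonAction4 U`, every `η`).
* §3 ★★ `wilsonAction4_background_expansion` — (26) = [5] (3.12) FOR THE ACTION OF RECORD: for every `η ≠ 0` and every `M_N(ℂ)`-valued bond field `A`,
  `A^η(e^{iηA}·U₀) = wilsonAction4 U₀ + ⟨A, J⟩ + ½⟨A, Δ(U₀)A⟩ + Σ_p ρ_p` (pv27's `eq312` with `hτ`, `hd` discharged; LEFT perturbation with print's `e^{iηA}`, cf. audit L2).
* §4 (27)–(28) and [5] (3.10) at objects, `hU` ∕ `hτ` ∕ `hτs` DISCHARGED: `eq27_cfgGL` ((27), hermitian `A`), `star_imPart`, ★ `J_torusT_cfgGL_eq_imPart_covDivT`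
  (`J = η⁻² Im D^{η*}_{U₀}∂U₀` with [6] (1.2)'s `covDivT`), `norm_J_cfgGL_le` (`‖J(b)‖ ≤ η⁻²‖(D*∂U₀)(b)‖` — (28)'s bound is this with (14)), `star_J_cfgGL` (the current is
  hermitian), `conj_bondPair_J_cfgGL` (`⟨A,J⟩` real), `star_deltaOp_cfgGL` (`Δ^η(U₀)` preserves hermiticity), `conj_bondPair_deltaOp_cfgGL`, `hessPair_im_cfgGL` (`⟨A,ΔA⟩` real).
* §5 (v1.1; audit D1) `coe_fluct`, ★ `prodCfg_eq_dirForm_expChart` (print's LEFT `e^{iηA}·U₀` at `A := (iη)⁻¹U₀XU₀*` IS dag-n07-e's RIGHT chart `expChart U₀ X`, 35a),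
  ★★★ `wilsonAction4_expChart_expansion` ((26) for `wilsonAction4 (expChart U₀ X)`, every `X : PBond → 𝔰𝔲(N)`, `η ≠ 0`).
* §6 (v1.1) `norm_J_lt_of_inUkClassB11` — (28)'s bound at the objects of record: `U₀ ∈ 𝔘_k(T, ε₀)` (dag-n01-b's `InUkClassB11`, the typed (14)) ⇒ `‖J(b)‖ < ε₀` at `η = η_k`.
* §7 (v1.1) `V0_cfgGL_eq_sum_rem3` (`V₀ = Σ_p ρ_p` at objects), `wilsonAction4_background_eq26_printed` ((26) letter for letter for the action of record, hermitian `A`).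
* §8 (v1.2) ★★★ `wilsonAction4_expChart_expansion_hessOpAt` — (26) as a REAL identity with the Hessian OPERATOR of record `Node00.hessOpAt η U₀` (audit D2, `Node00/HessianOperatorAtBackground`):
  `wilsonAction4 (expChart U₀ X) = wilsonAction4 U₀ + Re⟨A_X, J⟩ + ½·⟪X, Δ_{U₀}X⟫ + Re Σ_p ρ_p`.

HONEST FRAMING.  Exact finite algebra ∕ bookkeeping at the objects of record BY NAME; NO estimate of [15] is proved or asserted ((28)'s bound is the
IMPLICATION from the typed class (2), constant as typed); nothing of Bałaban's asserted; N07 NOT discharged; K1⁷ NOT closed; counts unmoved (28∕28 · 5∕27);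
one finite 𝕋⁴ programme at fixed `ε` — NOT continuum ∕ ℝ⁴ ∕ OS ∕ mass gap ∕ Clay.  0 `def`, 0 `sorry`, 0 `instance`, standard axioms.
-/

noncomputable section

namespace Summit.QuantumFields.YangMills.BalabanUVNodes.N07SectBExpansionAtObjects

open Literature.MathematicalPhysics.QuantumFieldTheory.Balaban1983to89
open Literature.MathematicalPhysics.QuantumFieldTheory.Balaban1983to89.Node00
open B9Eq37Insertion (wil reC imC)
open B9Eq39Adjoint (R plaqU curlη divPη bondPair hessPair rem3 prodCfg action posPlaq sum_posPlaq)
open B9TorusCalculus (torusT torusT_apply torusT_comm)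
open B12Eq18Current (dirForm dirForm_apply)
open B11Eq27Current (imPart plaqField)
open B10Eq68TorusRegularity (covDivT)
open MatrixNorms (ntr)
open scoped Matrix.Norms.L2Operator

variable {N : ℕ}

/-! ## §1 The trace functional of record `τ_N = N⁻¹·tr` as a `ℂ`-linear functional: tracial, `*`-compatible, normalised -/

/-- `τ_N X = ntr X` (the normalised complex trace of `MatrixNorms`, [4] (17)). [cite: Balaban1985Averaging, (17) p.20 (bookkeeping)] -/
theorem trN_apply (X : Matrix (Fin N) (Fin N) ℂ) :
    ((N : ℂ)⁻¹ • Matrix.traceLinearMap (Fin N) ℂ ℂ) X = ntr X := by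
  simp [ntr, div_eq_inv_mul]

/-- `τ_N` is tracial (`hτ` of pv27 ∕ `B11Eq27Current`). [cite: Balaban1985BackgroundPropagators, p.392 («X·Y = tr XY»; bookkeeping)] -/
theorem trN_mul_comm (a b : Matrix (Fin N) (Fin N) ℂ) :
    ((N : ℂ)⁻¹ • Matrix.traceLinearMap (Fin N) ℂ ℂ) (a * b) = ((N : ℂ)⁻¹ • Matrix.traceLinearMap (Fin N) ℂ ℂ) (b * a) := by
  simp [Matrix.trace_mul_comm a b]

/-- `τ_N` is `*`-compatible (`hτs` of `B11Eq27Current.eq27`): `τ_N(X*) = conj (τ_N X)`. [cite: Balaban1985Variational, (27) p.282 («from hermiticity»; bookkeeping)] -/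
theorem trN_star (a : Matrix (Fin N) (Fin N) ℂ) :
    ((N : ℂ)⁻¹ • Matrix.traceLinearMap (Fin N) ℂ ℂ) (star a) = starRingEnd ℂ (((N : ℂ)⁻¹ • Matrix.traceLinearMap (Fin N) ℂ ℂ) a) := by
  simp [Matrix.star_eq_conjTranspose, Matrix.trace_conjTranspose]

/-- `τ_N 1 = 1` («the trace is normalized, i.e., tr 1 = 1», [5] p. 392). [cite: Balaban1985BackgroundPropagators, p.392 (bookkeeping)] -/
theorem trN_one [NeZero N] : ((N : ℂ)⁻¹ • Matrix.traceLinearMap (Fin N) ℂ ℂ) 1 = 1 := by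
  have hN : (N : ℂ) ≠ 0 := Nat.cast_ne_zero.mpr (NeZero.ne N)
  simp [Matrix.trace_one, hN]

/-! ## §2 The background datum of record `(torusT P j, dirForm (cfgGL N U))` and the action of record -/

section Datum

variable [NeZero N] {P : Params} {j : ℕ}

omit [NeZero N] in
/-- The bond variables of the datum of record are the configuration's matrices: `(dirForm (cfgGL N U) μ x : M_N ℂ) = U ⟨x, μ⟩` (`rfl`). [cite: Balaban1985BackgroundPropagators, (3.1) p.390 (bookkeeping)] -/
theorem coe_dirForm_cfgGL (U : GaugeField P j (SU N)) (μ : Fin P.d) (x : Site P j) :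
    ((dirForm (cfgGL N U) μ x : (Matrix (Fin N) (Fin N) ℂ)ˣ) : Matrix (Fin N) (Fin N) ℂ) = ((U ⟨x, μ⟩ : SU N) : Matrix (Fin N) (Fin N) ℂ) := rfl

/-- ★ **pv27's plaquette unit at the datum of record IS the plaquette variable of record**: `(plaqU (torusT P j) (dirForm (cfgGL N U)) μ ν x : M_N ℂ) = plaqHol U ⟨x, μ, ν⟩`
(`U(∂p) = U(x,μ)U(x+e_μ,ν)U(x+e_ν,μ)⁻¹U(x,ν)⁻¹`, inverses = adjoints on `SU(N)`: dag-n01-b's `dirForm_cfgGL_inv_eq_star`, dag-n07-e's `coe_plaqHol_eq`).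
[cite: Balaban1985BackgroundPropagators, (3.1) p.390; Balaban1985Averaging, (9) p.19] -/
theorem coe_plaqU_torusT_cfgGL (U : GaugeField P j (SU N)) (x : Site P j) {μ ν : Fin P.d} (h : μ < ν) :
    ((plaqU (torusT P j) (dirForm (cfgGL N U)) μ ν x : (Matrix (Fin N) (Fin N) ℂ)ˣ) : Matrix (Fin N) (Fin N) ℂ) =
      ((GaugeField.plaqHol U ⟨x, μ, ν, h⟩ : SU N) : Matrix (Fin N) (Fin N) ℂ) := by
  rw [coe_plaqHol_eq, plaqU, Units.val_mul, Units.val_mul, Units.val_mul, dirForm_cfgGL_inv_eq_star, dirForm_cfgGL_inv_eq_star]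
  rfl

omit [NeZero N] in
/-- pv27's plaquette unit at the datum of record is unitary: `U(∂p)⁻¹ = U(∂p)*` (`B9Eq310Hermitian.plaqU_unitary` with `hU` discharged). [cite: Balaban1985BackgroundPropagators, (3.5) p.391 (bookkeeping)] -/
theorem plaqU_torusT_cfgGL_inv_eq_star (U : GaugeField P j (SU N)) (μ ν : Fin P.d) (x : Site P j) :
    (((plaqU (torusT P j) (dirForm (cfgGL N U)) μ ν x)⁻¹ : (Matrix (Fin N) (Fin N) ℂ)ˣ) : Matrix (Fin N) (Fin N) ℂ) =
      star ((plaqU (torusT P j) (dirForm (cfgGL N U)) μ ν x : (Matrix (Fin N) (Fin N) ℂ)ˣ) : Matrix (Fin N) (Fin N) ℂ) :=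
  B9Eq310Hermitian.plaqU_unitary (torusT P j) (dirForm (cfgGL N U)) (dirForm_cfgGL_inv_eq_star N U) μ ν x

/-- **`wil τ_N (U(∂p)) = 1 − reTr (plaqHol U p)`**: pv27's complexified one-plaquette functional `τ1 − τ Re U(∂p)` ([5] (3.1)) at the datum of record IS the
summand of the action of record (`reTr = Re tr ∕ N`, `Node00.reTr_eq_traceLinearMap`). [cite: Balaban1985BackgroundPropagators, (3.1) p.390; Balaban1987RG1, (0.2) p.252] -/
theorem wil_plaqU_cfgGL_eq (U : GaugeField P j (SU N)) (x : Site P j) {μ ν : Fin P.d} (h : μ < ν) :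
    wil ((N : ℂ)⁻¹ • Matrix.traceLinearMap (Fin N) ℂ ℂ) (plaqU (torusT P j) (dirForm (cfgGL N U)) μ ν x) =
      (((1 : ℝ) - reTr (GaugeField.plaqHol U ⟨x, μ, ν, h⟩) : ℝ) : ℂ) := by
  have hN : (N : ℂ) ≠ 0 := Nat.cast_ne_zero.mpr (NeZero.ne N)
  rw [wil, reC, plaqU_torusT_cfgGL_inv_eq_star, coe_plaqU_torusT_cfgGL U x h, reTr_eq_traceLinearMap, trN_one]
  set g : Matrix (Fin N) (Fin N) ℂ := ((GaugeField.plaqHol U ⟨x, μ, ν, h⟩ : SU N) : Matrix (Fin N) (Fin N) ℂ) with hg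
  have hcard : (Fintype.card (Fin N) : ℝ) = N := by rw [Fintype.card_fin]
  rw [hcard]
  simp only [map_smul, LinearMap.smul_apply, Matrix.traceLinearMap_apply, smul_eq_mul, Matrix.trace_add, Matrix.star_eq_conjTranspose,
    Matrix.trace_conjTranspose, Complex.star_def, Complex.add_conj]
  push_cast
  field_simp

/-- ★ **pv27's action at the datum of record IS THE ACTION OF RECORD**: `action (torusT P j) η 4 τ_N (dirForm (cfgGL N U)) = wilsonAction4 U` for every `η`
(at `d = 4` the weight `η^{d−4}` is `1`; the sum over `posPlaq` = the sum over `Plaq P j`, dag-n07-e's `sum_plaq_eq_sum_site`). [cite: Balaban1985BackgroundPropagators, (3.1) p.390; Balaban1987RG1, (0.2) p.252; Balaban1985Variational, (5) p.278] -/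
theorem action_torusT_cfgGL_eq_wilsonAction4 (η : ℝ) (U : GaugeField P j (SU N)) :
    action (torusT P j) η 4 ((N : ℂ)⁻¹ • Matrix.traceLinearMap (Fin N) ℂ ℂ) (dirForm (cfgGL N U)) = ((wilsonAction4 U : ℝ) : ℂ) := by
  rw [action, wilsonAction4, wilsonAction, Complex.ofReal_sum, sum_plaq_eq_sum_site]
  simp only [Nat.sub_self, pow_zero, one_mul]
  rw [sum_posPlaq (fun x μ ν => wil ((N : ℂ)⁻¹ • Matrix.traceLinearMap (Fin N) ℂ ℂ) (plaqU (torusT P j) (dirForm (cfgGL N U)) μ ν x))]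
  refine Finset.sum_congr rfl fun x _ => Finset.sum_congr rfl fun μ _ => Finset.sum_congr rfl fun ν _ => ?_
  by_cases h : μ < ν
  · rw [if_pos h, dif_pos h, wil_plaqU_cfgGL_eq U x h]
  · rw [if_neg h, dif_neg h]

end Datum

/-! ## §3 ★★ (26) = [5] (3.12) FOR THE ACTION OF RECORD: the exact expansion at an `SU(N)` background of record -/

section Expansion

variable [NeZero N] {P : Params} {j : ℕ}

/-- ★★ **[15] (26) ∕ [5] (3.12) FOR THE ACTION OF RECORD, EXACT**: for every `SU(N)` configuration of record `U₀` on `T^{(j)}`, every `η ≠ 0` and every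
`M_N(ℂ)`-valued bond field `A`, pv27's complexified action of the LEFT-perturbed configuration `e^{iηA}·U₀` (`B9Eq39Adjoint.prodCfg`, print's `U₁U₀`, (22)) equals
`wilsonAction4 U₀ + ⟨A, J⟩ + ½⟨A, Δ^η(U₀)A⟩ + Σ_p ρ_p` — `⟨A, J⟩ = bondPair … A (J …)` ((27) ∕ (3.11)), `⟨A, Δ(U₀)A⟩ = hessPair` ((3.10): `⟨A,D*DA⟩ + ⟨A,Δ′A⟩`), `ρ_p = rem3`
third order (pv27 `norm_rem3_le`); the weight `η^{d−4}` is `1` at `d = 4`.  `B9Eq39Adjoint.eq312` with `hτ` ∕ `hd` DISCHARGED and the zeroth-order term rewritten by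
`action_torusT_cfgGL_eq_wilsonAction4`.  (Reading it as `wilsonAction4` OF an `SU(N)` configuration needs `A` hermitian traceless, so that `e^{iηA} ∈ SU(N)` — audit D1; not used here.)
[cite: Balaban1985Variational, (26) p.282, (22) p.281; Balaban1985BackgroundPropagators, (3.12) p.392] -/
theorem wilsonAction4_background_expansion (η : ℝ) (hη : η ≠ 0) (U₀ : GaugeField P j (SU N)) (A : Fin P.d → Site P j → Matrix (Fin N) (Fin N) ℂ) :
    action (torusT P j) η 4 ((N : ℂ)⁻¹ • Matrix.traceLinearMap (Fin N) ℂ ℂ) (prodCfg (dirForm (cfgGL N U₀)) η A) =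
      ((wilsonAction4 U₀ : ℝ) : ℂ)
        + bondPair η 4 ((N : ℂ)⁻¹ • Matrix.traceLinearMap (Fin N) ℂ ℂ) A (B9Eq39Adjoint.J (torusT P j) (dirForm (cfgGL N U₀)) η)
        + 2⁻¹ * hessPair (torusT P j) (dirForm (cfgGL N U₀)) η 4 ((N : ℂ)⁻¹ • Matrix.traceLinearMap (Fin N) ℂ ℂ) A
        + ∑ q ∈ posPlaq (Site P j) (Fin P.d), rem3 (torusT P j) (dirForm (cfgGL N U₀)) η ((N : ℂ)⁻¹ • Matrix.traceLinearMap (Fin N) ℂ ℂ) A q.2.1 q.2.2 q.1 := by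
  rw [B9Eq39Adjoint.eq312 (torusT P j) (dirForm (cfgGL N U₀)) _ trN_mul_comm η hη le_rfl A, action_torusT_cfgGL_eq_wilsonAction4]
  simp only [Nat.sub_self, pow_zero, one_mul]

end Expansion

/-! ## §4 (27)–(28) and the operator `Δ^η(U₀)` of [5] (3.10) at an `SU(N)` background of record -/

section Current

variable {P : Params} {j : ℕ}

/-- **[15] (27) AT THE OBJECTS OF RECORD** (`B11Eq27Current.eq27` with `hU` ∕ `hτ` ∕ `hτs` DISCHARGED): for a HERMITIAN bond field `A` at an `SU(N)` background `U₀`,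
`Σ_p η² Im τ_N((DA)(p)U₀(∂p)) = Σ_p τ_N((DA)(p) η⁻²Im U₀(∂p)) = ⟨A, J⟩` («from hermiticity of DA»; `d = 4`, weights `η^4·(η⁻¹)²`).
[cite: Balaban1985Variational, (27) p.282; Balaban1985BackgroundPropagators, (3.11) p.392] -/
theorem eq27_cfgGL (η : ℝ) (U₀ : GaugeField P j (SU N)) {A : Fin P.d → Site P j → Matrix (Fin N) (Fin N) ℂ} (hA : ∀ μ x, star (A μ x) = A μ x) :
    ((η : ℂ) ^ 4 * ∑ q ∈ posPlaq (Site P j) (Fin P.d), ((η : ℂ)⁻¹) ^ 2 *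
        (((((N : ℂ)⁻¹ • Matrix.traceLinearMap (Fin N) ℂ ℂ) (curlη (torusT P j) (dirForm (cfgGL N U₀)) η A q.2.1 q.2.2 q.1 *
          (plaqU (torusT P j) (dirForm (cfgGL N U₀)) q.2.1 q.2.2 q.1 : Matrix (Fin N) (Fin N) ℂ))).im : ℝ) : ℂ) =
      (η : ℂ) ^ 4 * ∑ q ∈ posPlaq (Site P j) (Fin P.d),
        ((N : ℂ)⁻¹ • Matrix.traceLinearMap (Fin N) ℂ ℂ) (curlη (torusT P j) (dirForm (cfgGL N U₀)) η A q.2.1 q.2.2 q.1 *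
          ((((η : ℂ)⁻¹) ^ 2) • imC (plaqU (torusT P j) (dirForm (cfgGL N U₀)) q.2.1 q.2.2 q.1)))) ∧
    ((η : ℂ) ^ 4 * ∑ q ∈ posPlaq (Site P j) (Fin P.d),
        ((N : ℂ)⁻¹ • Matrix.traceLinearMap (Fin N) ℂ ℂ) (curlη (torusT P j) (dirForm (cfgGL N U₀)) η A q.2.1 q.2.2 q.1 *
          ((((η : ℂ)⁻¹) ^ 2) • imC (plaqU (torusT P j) (dirForm (cfgGL N U₀)) q.2.1 q.2.2 q.1))) =
      bondPair η 4 ((N : ℂ)⁻¹ • Matrix.traceLinearMap (Fin N) ℂ ℂ) A (B9Eq39Adjoint.J (torusT P j) (dirForm (cfgGL N U₀)) η)) :=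
  B11Eq27Current.eq27 (torusT P j) (dirForm (cfgGL N U₀)) (dirForm_cfgGL_inv_eq_star N U₀) _ trN_mul_comm trN_star η 4 hA

/-- `Im X = (2i)⁻¹(X − X*)` is hermitian (`B11Eq27Current.imPart`). [cite: Balaban1985Variational, (28) p.282 (bookkeeping)] -/
theorem star_imPart (X : Matrix (Fin N) (Fin N) ℂ) : star (imPart X) = imPart X := by
  rw [imPart, star_smul, star_sub, star_star, star_inv₀, star_mul, Complex.star_def, Complex.conj_I, map_ofNat]
  have h2 : (-Complex.I * 2)⁻¹ = -(2 * Complex.I)⁻¹ := by rw [mul_comm, ← neg_mul_eq_mul_neg, neg_inv]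
  rw [h2, neg_smul, ← smul_neg, neg_sub]

/-- ★ **(28)'s current READ WITH [6] (1.2)'s DIVERGENCE**: `J(b) = η⁻² · Im ((D^{η*}_{U₀} ∂U₀)(b))` with `B10Eq68TorusRegularity.covDivT` — the letter of [15] (2) ∕ n01-b's
`InUkClassB11` ∕ dag-n07-e's first-variation theorem (`B11Eq27Current.J_eq_imPart_div` ∘ dag-n01-b's `covDivT_eq_divPη`). [cite: Balaban1985Variational, (28) p.282; Balaban1985RegularSpaces, (1.2) p.76] -/
theorem J_torusT_cfgGL_eq_imPart_covDivT (η : ℝ) (U₀ : GaugeField P j (SU N)) (μ : Fin P.d) (x : Site P j) :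
    B9Eq39Adjoint.J (torusT P j) (dirForm (cfgGL N U₀)) η μ x = (((η : ℂ)⁻¹) ^ 2) • imPart (covDivT η (cfgGL N U₀) μ x) := by
  rw [B11Eq27Current.J_eq_imPart_div _ _ (dirForm_cfgGL_inv_eq_star N U₀), covDivT_eq_divPη]

/-- **(28)'s bound, sharp form at objects**: `‖J(b)‖ ≤ η⁻²·‖(D^{η*}_{U₀}∂U₀)(b)‖` (`‖Im X‖ ≤ ‖X‖`, operator norm) — so any bound on [15] (2)'s divergence letter (the
class `InUkClassB11` ∕ hypothesis (14)) is a bound on the current; print's `|J| < C₁B₃ε₁(Lʲη)⁻³` is this with (14). [cite: Balaban1985Variational, (28) p.282] -/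
theorem norm_J_cfgGL_le (η : ℝ) (U₀ : GaugeField P j (SU N)) (μ : Fin P.d) (x : Site P j) :
    ‖B9Eq39Adjoint.J (torusT P j) (dirForm (cfgGL N U₀)) η μ x‖ ≤ η⁻¹ ^ 2 * ‖covDivT η (cfgGL N U₀) μ x‖ := by
  rw [J_torusT_cfgGL_eq_imPart_covDivT, norm_smul, norm_pow, norm_inv, Complex.norm_real, Real.norm_eq_abs, ← abs_inv, sq_abs]
  exact mul_le_mul_of_nonneg_left (B11Eq27Current.norm_imPart_le _) (sq_nonneg _)

/-- **THE CURRENT OF (28) IS HERMITIAN at every `SU(N)` background of record**: `J(b)* = J(b)`. [cite: Balaban1985Variational, (28) p.282; Balaban1985BackgroundPropagators, (3.11) p.392] -/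
theorem star_J_cfgGL (η : ℝ) (U₀ : GaugeField P j (SU N)) (μ : Fin P.d) (x : Site P j) :
    star (B9Eq39Adjoint.J (torusT P j) (dirForm (cfgGL N U₀)) η μ x) = B9Eq39Adjoint.J (torusT P j) (dirForm (cfgGL N U₀)) η μ x := by
  rw [J_torusT_cfgGL_eq_imPart_covDivT, star_smul, B9Eq310Hermitian.star_eta_sq, star_imPart]

/-- `⟨A, J⟩` is REAL for hermitian `A` at an `SU(N)` background (`B9Eq310Hermitian.conj_bondPair` with `hτ` ∕ `hτs` discharged and `J` hermitian by `star_J_cfgGL`) —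
the linear term of (26). [cite: Balaban1985Variational, (27)–(28) p.282] -/
theorem conj_bondPair_J_cfgGL (η : ℝ) (U₀ : GaugeField P j (SU N)) {A : Fin P.d → Site P j → Matrix (Fin N) (Fin N) ℂ} (hA : ∀ μ x, star (A μ x) = A μ x) :
    starRingEnd ℂ (bondPair η 4 ((N : ℂ)⁻¹ • Matrix.traceLinearMap (Fin N) ℂ ℂ) A (B9Eq39Adjoint.J (torusT P j) (dirForm (cfgGL N U₀)) η)) =
      bondPair η 4 ((N : ℂ)⁻¹ • Matrix.traceLinearMap (Fin N) ℂ ℂ) A (B9Eq39Adjoint.J (torusT P j) (dirForm (cfgGL N U₀)) η) :=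
  B9Eq310Hermitian.conj_bondPair _ trN_mul_comm trN_star η 4 hA (fun μ x => star_J_cfgGL η U₀ μ x)

/-- **[5] (3.10)'s OPERATOR `Δ^η(U₀)` PRESERVES HERMITICITY at every `SU(N)` background of record** (`B9Eq310Hermitian.deltaOp_selfAdjoint`, `hU` discharged): for hermitian `A`,
`(Δ^η(U₀)A)(b)* = (Δ^η(U₀)A)(b)`. [cite: Balaban1985BackgroundPropagators, (3.10) p.392 («it is a hermitian operator»)] -/
theorem star_deltaOp_cfgGL (η : ℝ) (U₀ : GaugeField P j (SU N)) {A : Fin P.d → Site P j → Matrix (Fin N) (Fin N) ℂ} (hA : ∀ μ x, star (A μ x) = A μ x)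
    (μ : Fin P.d) (x : Site P j) :
    star (B9Eq310Hermitian.deltaOp (torusT P j) (dirForm (cfgGL N U₀)) η A μ x) = B9Eq310Hermitian.deltaOp (torusT P j) (dirForm (cfgGL N U₀)) η A μ x :=
  B9Eq310Hermitian.deltaOp_selfAdjoint _ _ (dirForm_cfgGL_inv_eq_star N U₀) η hA μ x

/-- `⟨A, Δ^η(U₀)A⟩` is REAL for hermitian `A` at an `SU(N)` background (`B9Eq310Hermitian.conj_bondPair_deltaOp`, hypotheses discharged) — the quadratic form of (26).
[cite: Balaban1985BackgroundPropagators, (3.10) p.392] -/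
theorem conj_bondPair_deltaOp_cfgGL (η : ℝ) (U₀ : GaugeField P j (SU N)) {A : Fin P.d → Site P j → Matrix (Fin N) (Fin N) ℂ} (hA : ∀ μ x, star (A μ x) = A μ x) :
    starRingEnd ℂ (bondPair η 4 ((N : ℂ)⁻¹ • Matrix.traceLinearMap (Fin N) ℂ ℂ) A (B9Eq310Hermitian.deltaOp (torusT P j) (dirForm (cfgGL N U₀)) η A)) =
      bondPair η 4 ((N : ℂ)⁻¹ • Matrix.traceLinearMap (Fin N) ℂ ℂ) A (B9Eq310Hermitian.deltaOp (torusT P j) (dirForm (cfgGL N U₀)) η A) :=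
  B9Eq310Hermitian.conj_bondPair_deltaOp _ _ (dirForm_cfgGL_inv_eq_star N U₀) _ trN_mul_comm trN_star η 4 hA

/-- **THE QUADRATIC FORM `⟨A, Δ^η(U₀)A⟩` OF (26) IS REAL** for hermitian `A` at an `SU(N)` background of record (`B9Eq310Hermitian.hessPair_im`, hypotheses discharged).
[cite: Balaban1985BackgroundPropagators, (3.10) p.392; Balaban1985Variational, (26) p.282] -/
theorem hessPair_im_cfgGL (η : ℝ) (U₀ : GaugeField P j (SU N)) {A : Fin P.d → Site P j → Matrix (Fin N) (Fin N) ℂ} (hA : ∀ μ x, star (A μ x) = A μ x) :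
    (hessPair (torusT P j) (dirForm (cfgGL N U₀)) η 4 ((N : ℂ)⁻¹ • Matrix.traceLinearMap (Fin N) ℂ ℂ) A).im = 0 :=
  B9Eq310Hermitian.hessPair_im _ _ (dirForm_cfgGL_inv_eq_star N U₀) _ trN_mul_comm trN_star η 4 hA

end Current

/-! ## §5 (v1.1) (26) FOR `SU(N)` CONFIGURATIONS IN NODE 00's CHART `expChart` — audit D1: print's LEFT hermitian perturbation `e^{iηA}·U₀` (pv27 `prodCfg`) IS
dag-n07-e's RIGHT skew chart `U₀·exp X` (35a `Node00/CriticalOnFibreTangent.expChart`) at `A(b) := (iη)⁻¹·U₀(b)X(b)U₀(b)*` -/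

section Chart

variable [NeZero N] {P : Params} {j : ℕ}

omit [NeZero N] in
/-- pv27's fluctuation unit IS `exp(iηA)` bondwise: `(fluct η A μ x : M_N ℂ) = exp ((iη)·A μ x)` (`B9Eq37Insertion.val_holU`, `holonomy [Y] = exp Y`).
[cite: Balaban1985Variational, (22) p.281; Balaban1985BackgroundPropagators, (3.1) p.390 («U′ = exp iηA»)] -/
theorem coe_fluct (η : ℝ) (A : Fin P.d → Site P j → Matrix (Fin N) (Fin N) ℂ) (μ : Fin P.d) (x : Site P j) :
    ((B9Eq39Adjoint.fluct η A μ x : (Matrix (Fin N) (Fin N) ℂ)ˣ) : Matrix (Fin N) (Fin N) ℂ) = NormedSpace.exp ((Complex.I * η : ℂ) • A μ x) := by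
  rw [B9Eq39Adjoint.fluct, B9Eq37Insertion.val_holU, Beta.TransportVertices.holonomy_cons, Beta.TransportVertices.holonomy_nil, mul_one]

omit [NeZero N] in
/-- ★ **PRINT'S LEFT PERTURBATION IS NODE 00's RIGHT CHART** (audit D1): for `X : PBond → 𝔰𝔲(N)` and `η ≠ 0`, with print's letter `A(x,μ) := (iη)⁻¹·U₀X U₀*` at the bond
`⟨x, μ⟩`, pv27's `prodCfg (dirForm (cfgGL N U₀)) η A` («U₁U₀, U₁ = e^{iηA}», (22) ∕ [5] (3.1)) IS the datum of dag-n07-e's `expChart U₀ X = U₀·exp X` (35a) — since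
`exp(U₀XU₀*)U₀ = U₀ exp(X) U₀*U₀ = U₀ exp X` (`T4AdjointCovarianceUnitary.exp_conj_unitary`). [cite: Balaban1985Variational, (22) p.281; Balaban1985RegularSpaces, (1.10) p.77] -/
theorem prodCfg_eq_dirForm_expChart {η : ℝ} (hη : η ≠ 0) (U₀ : GaugeField P j (SU N)) (X : PBond P j → T4AdjointCovarianceUnitary.lieSU (Fin N)) :
    prodCfg (dirForm (cfgGL N U₀)) η
        (fun μ x => ((Complex.I * η : ℂ))⁻¹ •
          (((U₀ ⟨x, μ⟩ : SU N) : Matrix (Fin N) (Fin N) ℂ) * ((X ⟨x, μ⟩ : T4AdjointCovarianceUnitary.lieSU (Fin N)) : Matrix (Fin N) (Fin N) ℂ) *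
            star ((U₀ ⟨x, μ⟩ : SU N) : Matrix (Fin N) (Fin N) ℂ))) =
      dirForm (cfgGL N (expChart U₀ X)) := by
  have hI : (Complex.I * η : ℂ) ≠ 0 := mul_ne_zero Complex.I_ne_zero (Complex.ofReal_ne_zero.mpr hη)
  funext μ x
  ext
  rw [prodCfg, Units.val_mul, coe_fluct, smul_smul, mul_inv_cancel₀ hI, one_smul, coe_dirForm_cfgGL, coe_dirForm_cfgGL, coe_expChart]
  have hU : star ((U₀ ⟨x, μ⟩ : SU N) : Matrix (Fin N) (Fin N) ℂ) * ((U₀ ⟨x, μ⟩ : SU N) : Matrix (Fin N) (Fin N) ℂ) = 1 :=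
    Unitary.star_mul_self_of_mem (U₀ ⟨x, μ⟩).2.1
  have h := T4AdjointCovarianceUnitary.exp_conj_unitary ⟨((U₀ ⟨x, μ⟩ : SU N) : Matrix (Fin N) (Fin N) ℂ), (U₀ ⟨x, μ⟩).2.1⟩
    ((X ⟨x, μ⟩ : T4AdjointCovarianceUnitary.lieSU (Fin N)) : Matrix (Fin N) (Fin N) ℂ)
  simp only at h
  rw [h, mul_assoc, hU, mul_one]

/-- ★★★ **[15] (26) ∕ [5] (3.12) FOR THE ACTION OF RECORD AT AN `SU(N)` CONFIGURATION IN NODE 00's CHART**: for every `SU(N)` background `U₀` on `T^{(j)}`, every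
`X : PBond → 𝔰𝔲(N)` and `η ≠ 0`, with print's letter `A := (iη)⁻¹·U₀XU₀*`:
`wilsonAction4 (U₀·exp X) = wilsonAction4 U₀ + ⟨A, J⟩ + ½⟨A, Δ^η(U₀)A⟩ + Σ_p ρ_p` (EXACT; `J` = (28)'s current = `η⁻²·Im D^{η*}_{U₀}∂U₀` by `J_torusT_cfgGL_eq_imPart_covDivT`,
`⟨A,Δ(U₀)A⟩ = hessPair` (3.10), `ρ_p = rem3` third order) — §3 transported through `prodCfg_eq_dirForm_expChart` and `action_torusT_cfgGL_eq_wilsonAction4`.  The first-order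
term's derivative form is dag-n07-e's `hasDerivAt_wilsonAction4_expChart_covDivT` (35f); this is the finite expansion with the SECOND-order term and the remainder.
[cite: Balaban1985Variational, (26) p.282; Balaban1985BackgroundPropagators, (3.12) p.392] -/
theorem wilsonAction4_expChart_expansion {η : ℝ} (hη : η ≠ 0) (U₀ : GaugeField P j (SU N)) (X : PBond P j → T4AdjointCovarianceUnitary.lieSU (Fin N)) :
    ((wilsonAction4 (expChart U₀ X) : ℝ) : ℂ) =
      ((wilsonAction4 U₀ : ℝ) : ℂ)
        + bondPair η 4 ((N : ℂ)⁻¹ • Matrix.traceLinearMap (Fin N) ℂ ℂ)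
            (fun μ x => ((Complex.I * η : ℂ))⁻¹ •
              (((U₀ ⟨x, μ⟩ : SU N) : Matrix (Fin N) (Fin N) ℂ) * ((X ⟨x, μ⟩ : T4AdjointCovarianceUnitary.lieSU (Fin N)) : Matrix (Fin N) (Fin N) ℂ) *
                star ((U₀ ⟨x, μ⟩ : SU N) : Matrix (Fin N) (Fin N) ℂ)))
            (B9Eq39Adjoint.J (torusT P j) (dirForm (cfgGL N U₀)) η)
        + 2⁻¹ * hessPair (torusT P j) (dirForm (cfgGL N U₀)) η 4 ((N : ℂ)⁻¹ • Matrix.traceLinearMap (Fin N) ℂ ℂ)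
            (fun μ x => ((Complex.I * η : ℂ))⁻¹ •
              (((U₀ ⟨x, μ⟩ : SU N) : Matrix (Fin N) (Fin N) ℂ) * ((X ⟨x, μ⟩ : T4AdjointCovarianceUnitary.lieSU (Fin N)) : Matrix (Fin N) (Fin N) ℂ) *
                star ((U₀ ⟨x, μ⟩ : SU N) : Matrix (Fin N) (Fin N) ℂ)))
        + ∑ q ∈ posPlaq (Site P j) (Fin P.d), rem3 (torusT P j) (dirForm (cfgGL N U₀)) η ((N : ℂ)⁻¹ • Matrix.traceLinearMap (Fin N) ℂ ℂ)
            (fun μ x => ((Complex.I * η : ℂ))⁻¹ •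
              (((U₀ ⟨x, μ⟩ : SU N) : Matrix (Fin N) (Fin N) ℂ) * ((X ⟨x, μ⟩ : T4AdjointCovarianceUnitary.lieSU (Fin N)) : Matrix (Fin N) (Fin N) ℂ) *
                star ((U₀ ⟨x, μ⟩ : SU N) : Matrix (Fin N) (Fin N) ℂ))) q.2.1 q.2.2 q.1 := by
  rw [← action_torusT_cfgGL_eq_wilsonAction4 η (expChart U₀ X), ← prodCfg_eq_dirForm_expChart hη U₀ X]
  exact wilsonAction4_background_expansion η hη U₀ _

end Chart

/-! ## §6 (v1.1) (28)'s BOUND IN THE CURRENCY OF RECORD: at a background in NODE 00's class (2) `𝔘_k(T, ε₀)` (dag-n01-b's `InUkClassB11`, the typed (14)) the current is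
smaller than `ε₀` bondwise at the scale `η = η_k` -/

section Record

open T4Continuum (T4Family)

variable [NeZero N] (F : T4Family)

/-- **[15] (28)'s bound «|J| < C₁B₃ε₁(Lʲη)⁻³ … by the assumption (14)» AT THE OBJECTS OF RECORD**: if `U₀ ∈ 𝔘_k(T, ε₀)` (dag-n01-b's `Node00.InUkClassB11 F N K k ε₀ U₀`
= [15] (2) at `Ω_j = T`, the typed form of (14) with radius `ε₀`; `0 ≤ ε₀`), then at the scale `η = η_k` of record `‖J(b)‖ < ε₀` at EVERY bond — `norm_J_cfgGL_le` composed with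
the class's divergence clause read as in dag-n01-b's `currentSmall_of_regDivAt` (the tree's class absorbs print's scale factors `(Lʲη)⁻³` into its radius).
[cite: Balaban1985Variational, (28) p.282, (14) p.280, (2) p.278] -/
theorem norm_J_lt_of_inUkClassB11 {K k : ℕ} {ε₀ : ℝ} (hε : 0 ≤ ε₀) {U₀ : GaugeField (F.P K) 0 (SU N)} (h : InUkClassB11 F N K k ε₀ U₀)
    (b : PBond (F.P K) 0) :
    ‖B9Eq39Adjoint.J (torusT (F.P K) 0) (dirForm (cfgGL N U₀)) ((F.P K).eta k) b.dir b.src‖ < ε₀ := by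
  have hη : 0 < (F.P K).eta k := pow_pos (inv_pos.mpr (Nat.cast_pos.mpr (F.P K).L_pos)) k
  have hb := ((inUkClassB11_iff hε U₀).1 h).2 b (Or.inl (Set.mem_univ _))
  rw [B12Eq115BackgroundPair.pow_mul_eta, inv_one, mul_one, inv_pow_sq_eq_eta_sq] at hb
  refine (norm_J_cfgGL_le ((F.P K).eta k) U₀ b.dir b.src).trans_lt ?_
  have hpos : 0 < ((F.P K).eta k)⁻¹ ^ 2 := by positivity
  calc ((F.P K).eta k)⁻¹ ^ 2 * ‖covDivT ((F.P K).eta k) (cfgGL N U₀) b.dir b.src‖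
      < ((F.P K).eta k)⁻¹ ^ 2 * (ε₀ * (F.P K).eta k ^ 2) := mul_lt_mul_of_pos_left hb hpos
    _ = ε₀ := by field_simp

end Record

/-! ## §7 (v1.1) (26) AS PRINTED, with the letter `V₀` (`B11Eq26ActionExpansion.V0`), at an `SU(N)` background of record -/

section V0

variable [NeZero N] {P : Params} {j : ℕ}

omit [NeZero N] in
/-- **`V₀` IS THE THIRD-ORDER REMAINDER at the objects of record**: `V₀(A) = Σ_p ρ_p` (`B11Eq26ActionExpansion.V0_eq_sum_rem3` with `hτ`, `hd` discharged; weight `η^{d−4} = 1`).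
[cite: Balaban1985Variational, (26) p.282 («the expansion of V₀(A) begins with a third order polynomial»), (29)–(30) p.282] -/
theorem V0_cfgGL_eq_sum_rem3 (η : ℝ) (hη : η ≠ 0) (U₀ : GaugeField P j (SU N)) (A : Fin P.d → Site P j → Matrix (Fin N) (Fin N) ℂ) :
    B11Eq26ActionExpansion.V0 (torusT P j) (dirForm (cfgGL N U₀)) η 4 ((N : ℂ)⁻¹ • Matrix.traceLinearMap (Fin N) ℂ ℂ) A =
      ∑ q ∈ posPlaq (Site P j) (Fin P.d), rem3 (torusT P j) (dirForm (cfgGL N U₀)) η ((N : ℂ)⁻¹ • Matrix.traceLinearMap (Fin N) ℂ ℂ) A q.2.1 q.2.2 q.1 := by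
  rw [B11Eq26ActionExpansion.V0_eq_sum_rem3 (torusT P j) (dirForm (cfgGL N U₀)) _ trN_mul_comm η hη le_rfl A]
  simp only [Nat.sub_self, pow_zero, one_mul]

/-- **[15] (26) LETTER FOR LETTER FOR THE ACTION OF RECORD** (`B11Eq26ActionExpansion.eq26_printed` with `hU`, `hτ`, `hτs` DISCHARGED and the zeroth-order term = `wilsonAction4 U₀`):
for hermitian `A`, `A(e^{iηA}U₀) = wilsonAction4 U₀ + Σ_p η² Im τ_N((DA)(p)U₀(∂p)) + ½⟨A, ΔA⟩ + V₀(A)`. [cite: Balaban1985Variational, (26)–(27) p.282] -/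
theorem wilsonAction4_background_eq26_printed (η : ℝ) (U₀ : GaugeField P j (SU N)) {A : Fin P.d → Site P j → Matrix (Fin N) (Fin N) ℂ}
    (hA : ∀ μ x, star (A μ x) = A μ x) :
    action (torusT P j) η 4 ((N : ℂ)⁻¹ • Matrix.traceLinearMap (Fin N) ℂ ℂ) (prodCfg (dirForm (cfgGL N U₀)) η A) =
      ((wilsonAction4 U₀ : ℝ) : ℂ)
        + (η : ℂ) ^ 4 * ∑ q ∈ posPlaq (Site P j) (Fin P.d), ((η : ℂ)⁻¹) ^ 2 *
            (((((N : ℂ)⁻¹ • Matrix.traceLinearMap (Fin N) ℂ ℂ) (curlη (torusT P j) (dirForm (cfgGL N U₀)) η A q.2.1 q.2.2 q.1 *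
              (plaqU (torusT P j) (dirForm (cfgGL N U₀)) q.2.1 q.2.2 q.1 : Matrix (Fin N) (Fin N) ℂ))).im : ℝ) : ℂ)
        + 2⁻¹ * hessPair (torusT P j) (dirForm (cfgGL N U₀)) η 4 ((N : ℂ)⁻¹ • Matrix.traceLinearMap (Fin N) ℂ ℂ) A
        + B11Eq26ActionExpansion.V0 (torusT P j) (dirForm (cfgGL N U₀)) η 4 ((N : ℂ)⁻¹ • Matrix.traceLinearMap (Fin N) ℂ ℂ) A := by
  rw [B11Eq26ActionExpansion.eq26_printed (torusT P j) (dirForm (cfgGL N U₀)) (dirForm_cfgGL_inv_eq_star N U₀) _ trN_mul_comm trN_star η 4 hA,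
    action_torusT_cfgGL_eq_wilsonAction4]

end V0

/-! ## §8 (v1.2) (26) for the action of record with the Hessian OPERATOR `Δ_{U₀}` of `Node00/HessianOperatorAtBackground` -/

section Link
open scoped InnerProductSpace
variable {N : ℕ} [NeZero N] {P : Params} {j : ℕ}

/-- ★★★ **[15] (26) FOR THE ACTION OF RECORD WITH THE HESSIAN OPERATOR OF RECORD** (v1.2; audit D2 landed as `Node00/HessianOperatorAtBackground`): for every `SU(N)` background
`U₀`, tangent direction `X : PBond → 𝔰𝔲(N)` and `η ≠ 0`, with print's letter `A_X = hermLetter η U₀ X`: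
`wilsonAction4 (U₀·exp X) = wilsonAction4 U₀ + Re⟨A_X, J⟩ + ½·⟪X, Δ_{U₀} X⟫ + Re Σ_p ρ_p` — REAL statement; `Δ_{U₀} = Node00.hessOpAt η U₀` the symmetric operator on
`TangentBondSU P j N` (`Node00.inner_hessOpAt_self`), `J` the current of (28), `ρ_p = rem3` third order.  §5's `wilsonAction4_expChart_expansion` read through `Complex.re`.
[cite: Balaban1985Variational, (26) p.282; Balaban1985BackgroundPropagators, (3.10)–(3.12) p.392] -/
theorem wilsonAction4_expChart_expansion_hessOpAt {η : ℝ} (hη : η ≠ 0) (U₀ : GaugeField P j (SU N)) (X : TangentBondSU P j N) :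
    wilsonAction4 (expChart U₀ X) =
      wilsonAction4 U₀
        + (bondPair η 4 ((N : ℂ)⁻¹ • Matrix.traceLinearMap (Fin N) ℂ ℂ) (hermLetter η U₀ X) (B9Eq39Adjoint.J (torusT P j) (dirForm (cfgGL N U₀)) η)).re
        + 2⁻¹ * ⟪X, hessOpAt η U₀ X⟫_ℝ
        + (∑ q ∈ posPlaq (Site P j) (Fin P.d), rem3 (torusT P j) (dirForm (cfgGL N U₀)) η ((N : ℂ)⁻¹ • Matrix.traceLinearMap (Fin N) ℂ ℂ) (hermLetter η U₀ X) q.2.1 q.2.2 q.1).re := by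
  have h := congrArg Complex.re (wilsonAction4_expChart_expansion hη U₀ X)
  rw [inner_hessOpAt_self]
  simp only [Complex.ofReal_re, Complex.add_re] at h
  rw [h]
  have h2 : ((2⁻¹ : ℂ) * hessPair (torusT P j) (dirForm (cfgGL N U₀)) η 4 ((N : ℂ)⁻¹ • Matrix.traceLinearMap (Fin N) ℂ ℂ) (hermLetter η U₀ X)).re =
      2⁻¹ * (hessPair (torusT P j) (dirForm (cfgGL N U₀)) η 4 ((N : ℂ)⁻¹ • Matrix.traceLinearMap (Fin N) ℂ ℂ) (hermLetter η U₀ X)).re := by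
    rw [show (2⁻¹ : ℂ) = ((2⁻¹ : ℝ) : ℂ) by push_cast; ring, Complex.re_ofReal_mul]
  rw [← h2]
  rfl

end Link

end Summit.QuantumFields.YangMills.BalabanUVNodes.N07SectBExpansionAtObjects

end
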